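import Mathlib
import HarnessLib
import Summits.HubbardSuperconductivity.HubbardSuperconductivity.Theorems.KLProgrammeKLRegimeTwoVolumeSpineDataDefs
import Summits.HubbardSuperconductivity.HubbardSuperconductivity.Theorems.KLProgrammeKLRegimeTwoVolumeDefectTannery
import Summits.HubbardSuperconductivity.HubbardSuperconductivity.Theorems.KLProgrammeKLRegimeTwoVolumeTorusBlocks
import Summits.HubbardSuperconductivity.HubbardSuperconductivity.Theorems.KLProgrammeKLRegimeTwoVolumeGluedTruncation

/-!
# Route `KLProgramme` — crux K3, VL child `KLRegimeVolumeLimitV17F2` (stmt-HubbardSuperconductivity-20440), blueprint v5 M5 / W5: SMALL KIT OF THE TOWER SPINE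
# ASSEMBLY (seat hubbard-kl-k3c4-p1 g13; `--supports` 20440)

Model-free bookkeeping used by `…TwoVolumeTowerSpine` (the limit spine on the named tower):

* profiles: `WtProfileRaw.mono`, `WtProfileRaw.unweighted` (the plain pinned profile is below the weighted one), **`wtProfileRaw_of_wtProfileEven`** (an EVEN
  element with an even-degree weighted profile `N` has the raw-degree profile `k ↦ [k even]·N(k/2)` — the state of step `0` of the tower is read off E1's even
  profile by parity);
* the everywhere two-volume defect from two raw profiles: `sum_filter_norm_keyedGlued_le_of_wtProfileRaw`;
* depth in the residue torus: **`deepRes_of_tnorm_le`** (a fine site within torus distance `R` of a `(D+R)`-deep fine site is `D`-deep — depth measured by the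
  residues modulo the coarse period `L`; contrapositive of `far_of_not_deep_of_deep`);
* the sources of the spine: `tendsto_inv_one_add_mul_atTop_nat`, `tendsto_const_div_one_add_mul_atTop_nat`, `tendsto_one_add_mul_atTop_nat`,
  `tendsto_mul_add_one_atTop_nat` (`(1 + Λ(r_L + 1))⁻¹ → 0`, `c/(1 + Λ(r_L+1)) → 0`, `1 + Λ(r_L+1) → ∞`, `Λ(r_L+1) → ∞` for `Λ > 0`, `r_L → ∞`);
* `normV_le_of_hasSum` (`normV Γ K ρ N ≤ ν` when the full series has sum `ν` and `N ≥ 0`).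

Pure bookkeeping; no definition.
-/

noncomputable section

namespace Summit.HubbardSuperconductivity.HubbardSuperconductivity.Theorems.TwoVolumeDefect

set_option linter.dupNamespace false -- summit = problem name (single-conjunct summit), D-0017

open Finset Filter Topology Literature.MathematicalPhysics.QuantumLattice GrassmannAlgebra Literature.Probability.LatticeModels
  Literature.Probability.LatticeModels.BattleFederbush

/-! ## §1 Profiles -/

section Profiles

variable {V M Ns : ℕ} [NeZero V] {W : GrassmannAlgebra ℂ ((SpaceTimeIdx V M × SectorLeg Ns) × Fin 2)} {Λ : ℝ}

/-- A weighted raw profile stays one under a larger budget. [folklore] -/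
theorem WtProfileRaw.mono {N N' : ℕ → ℝ} (h : WtProfileRaw W Λ N) (hle : ∀ k, N k ≤ N' k) : WtProfileRaw W Λ N' :=
  ⟨fun k => (h.nonneg k).trans (hle k), fun k p y => (h.le k p y).trans (hle k)⟩

/-- **The plain pinned profile is below the weighted one** (the weight `1 + labelDiam ≥ 1`). [folklore] -/
theorem WtProfileRaw.unweighted {N : ℕ → ℝ} (h : WtProfileRaw W Λ N) (k : ℕ) (p : Fin k) (y : (SpaceTimeIdx V M × SectorLeg Ns) × Fin 2) :
    ∑ Y ∈ univ.filter (fun Y : Fin k → (SpaceTimeIdx V M × SectorLeg Ns) × Fin 2 => Y p = y), ‖kernel ℂ W k Y‖ ≤ N k := by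
  refine le_trans (sum_le_sum fun Y _ => ?_) (h.le k p y)
  exact le_mul_of_one_le_right (norm_nonneg _) (le_add_of_nonneg_right (labelDiam_nonneg _ _))

/-- **Raw profile of an even element from its even-degree profile**: `k ↦ [k even] · N (k/2)`. [folklore] -/
theorem wtProfileRaw_of_wtProfileEven {N : ℕ → ℝ} (hW : W ∈ evenOdd ℂ 0) (h : WtProfileEven W Λ N) :
    WtProfileRaw W Λ (fun k => if Even k then N (k / 2) else 0) := by
  refine ⟨fun k => ?_, fun k p y => ?_⟩
  · split_ifs
    · exact h.nonneg _
    · exact le_rfl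
  · by_cases hk : Even k
    · obtain ⟨m', rfl⟩ : 2 ∣ k := even_iff_two_dvd.mp hk
      rw [if_pos hk, Nat.mul_div_cancel_left m' two_pos]
      exact h.le m' p y
    · rw [if_neg hk]
      refine (sum_eq_zero fun Y _ => ?_).le
      rw [kernel_eq_zero_of_mem_evenPart_of_odd ℂ ((mem_evenPart_iff).2 hW) (Nat.not_even_iff_odd.mp hk) Y, norm_zero, zero_mul]

end Profiles

/-! ## §2 The everywhere two-volume defect from two raw profiles -/

/-- **The everywhere keyed defect is below the sum of the two raw profiles** (fine at the pin, coarse at its residue). [folklore] -/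
theorem sum_filter_norm_keyedGlued_le_of_wtProfileRaw {b L Lf M N₁ : ℕ} [NeZero L] [NeZero Lf]
    (ed₁ : ((SpaceTimeIdx Lf M × SectorLeg N₁) × Fin 2) ≃ (Fin 2 → Fin b) × ((SpaceTimeIdx L M × SectorLeg N₁) × Fin 2))
    {𝒲' : GrassmannAlgebra ℂ ((SpaceTimeIdx Lf M × SectorLeg N₁) × Fin 2)} {𝒲 : GrassmannAlgebra ℂ ((SpaceTimeIdx L M × SectorLeg N₁) × Fin 2)}
    {Λ' Λ : ℝ} {N' N : ℕ → ℝ} (h' : WtProfileRaw 𝒲' Λ' N') (h : WtProfileRaw 𝒲 Λ N) (k : ℕ) (p : Fin k) (y' : (SpaceTimeIdx Lf M × SectorLeg N₁) × Fin 2) :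
    ∑ Y' ∈ univ.filter (fun Y' : Fin k → (SpaceTimeIdx Lf M × SectorLeg N₁) × Fin 2 => Y' p = y'),
      ‖kernel ℂ 𝒲' k Y' - (if ∀ i, (ed₁ (Y' i)).1 = (ed₁ (Y' p)).1 then kernel ℂ 𝒲 k (fun i => (ed₁ (Y' i)).2) else 0)‖ ≤ N' k + N k := by
  classical
  exact sum_filter_norm_keyedGlued_le_of_profiles ed₁ 𝒲' 𝒲 p y' (h'.unweighted k p y') (h.unweighted k p _)

/-! ## §3 Depth in the residue torus -/

/-- **A fine site within `R` of a `(D+R)`-deep fine site is `D`-deep** (depth = every residue coordinate modulo the coarse period `m` in `[·, m − ·)`).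
[folklore] -/
theorem deepRes_of_tnorm_le {d b m Mf : ℕ} [NeZero Mf] [NeZero m] (hM : Mf = b * m) {D R : ℕ} {x y : TorusSite d Mf}
    (hx : ∀ j, D + R ≤ (x j).val % m ∧ (x j).val % m + (D + R) < m) (hxy : Torus.tnorm (x - y) ≤ R) :
    ∀ j, D ≤ (y j).val % m ∧ (y j).val % m + D < m := by
  by_contra hy
  have hfar : R < Torus.tnorm (y - x) := far_of_not_deep_of_deep hM hy hx
  rw [← Torus.tnorm_neg, neg_sub] at hfar
  exact absurd hxy (not_le.2 hfar)

/-! ## §4 The sources of the spine -/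

/-- `1 + Λ (r_L + 1) → +∞` for `Λ > 0` and `r_L → ∞`. [folklore] -/
theorem tendsto_one_add_mul_atTop_nat {Λ : ℝ} (hΛ : 0 < Λ) {r : ℕ → ℕ} (hr : Tendsto r atTop atTop) :
    Tendsto (fun L => 1 + Λ * ((r L : ℝ) + 1)) atTop atTop := by
  have h1 : Tendsto (fun L => (r L : ℝ) + 1) atTop atTop :=
    tendsto_atTop_add_const_right _ 1 (tendsto_natCast_atTop_atTop.comp hr)
  exact tendsto_atTop_add_const_left _ 1 (h1.const_mul_atTop hΛ)

/-- `Λ (r_L + 1) → +∞` for `Λ > 0` and `r_L → ∞`. [folklore] -/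
theorem tendsto_mul_add_one_atTop_nat {Λ : ℝ} (hΛ : 0 < Λ) {r : ℕ → ℕ} (hr : Tendsto r atTop atTop) :
    Tendsto (fun L => Λ * ((r L : ℝ) + 1)) atTop atTop :=
  (tendsto_atTop_add_const_right _ 1 (tendsto_natCast_atTop_atTop.comp hr)).const_mul_atTop hΛ

/-- `(1 + Λ (r_L + 1))⁻¹ → 0` for `Λ > 0` and `r_L → ∞`. [folklore] -/
theorem tendsto_inv_one_add_mul_atTop_nat {Λ : ℝ} (hΛ : 0 < Λ) {r : ℕ → ℕ} (hr : Tendsto r atTop atTop) :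
    Tendsto (fun L => (1 + Λ * ((r L : ℝ) + 1))⁻¹) atTop (𝓝 0) :=
  (tendsto_one_add_mul_atTop_nat hΛ hr).inv_tendsto_atTop

/-- `c / (1 + Λ (r_L + 1)) → 0` for `Λ > 0` and `r_L → ∞`. [folklore] -/
theorem tendsto_const_div_one_add_mul_atTop_nat {Λ : ℝ} (hΛ : 0 < Λ) (c : ℝ) {r : ℕ → ℕ} (hr : Tendsto r atTop atTop) :
    Tendsto (fun L => c / (1 + Λ * ((r L : ℝ) + 1))) atTop (𝓝 0) := by
  simpa only [div_eq_mul_inv, mul_zero] using (tendsto_inv_one_add_mul_atTop_nat hΛ hr).const_mul c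

/-- `c · (1 + Λ (r_L + 1))⁻¹ → 0` for `Λ > 0` and `r_L → ∞`. [folklore] -/
theorem tendsto_inv_one_add_mul_mul_atTop_nat {Λ : ℝ} (hΛ : 0 < Λ) (c : ℝ) {r : ℕ → ℕ} (hr : Tendsto r atTop atTop) :
    Tendsto (fun L => (1 + Λ * ((r L : ℝ) + 1))⁻¹ * c) atTop (𝓝 0) := by
  simpa only [zero_mul] using (tendsto_inv_one_add_mul_atTop_nat hΛ hr).mul_const c

/-! ## §5 `normV` under a named series -/

/-- **`normV Γ K ρ N ≤ ν`** when the full series `Σ (e²(K+ρ))^{2m} N m` has sum `ν` (`N ≥ 0`, `K, ρ ≥ 0`). [folklore] -/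
theorem normV_le_of_hasSum {Γ : Type*} [Fintype Γ] {K ρ : ℝ} (hK : 0 ≤ K) (hρ : 0 ≤ ρ) {N : ℕ → ℝ} (hN : ∀ m, 0 ≤ N m) {ν : ℝ}
    (h : HasSum (fun m => (Real.exp 2 * (K + ρ)) ^ (2 * m) * N m) ν) : normV Γ K ρ N ≤ ν := by
  rw [← h.tsum_eq]
  exact normV_le_tsum_of_le hK hρ hN (fun m => le_rfl) h.summable

/-- The sum of a nonnegative series is nonnegative. [folklore] -/
theorem HasSum.nonneg_of_nonneg {f : ℕ → ℝ} {ν : ℝ} (h : HasSum f ν) (hf : ∀ m, 0 ≤ f m) : 0 ≤ ν := by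
  rw [← h.tsum_eq]; exact tsum_nonneg hf

end Summit.HubbardSuperconductivity.HubbardSuperconductivity.Theorems.TwoVolumeDefect

end
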